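import Mathlib
import Literature.MathematicalPhysics.QuantumFieldTheory.Dimock2011to13.StarFormIdentity
import Literature.MathematicalPhysics.QuantumFieldTheory.Dimock2011to13.MultiRegionFreeFlow
import Literature.MathematicalPhysics.QuantumFieldTheory.Dimock2011to13.BlockAveragingMatrix

/-!
# Dimock, *The renormalization group according to Balaban* II, §2.4 "a variation": the localized action
# `S*_k(Λ, Φ_k, φ)` with half the boundary bonds, its polarization, and LEMMA 2.4 — the expansion about
# `φ_{k,Ω}` with the boundary term `𝔟_Λ(∂φ_{k,Ω}, 𝒵)` — PROVED on the graph carrier of `StarFormIdentity`;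
# v1.1: its hypothesis (H1) DERIVED from Theorem 2.1 (`MultiRegionFreeFlow.variational_eq`) at the sites of `Λ`

**Citation header (reproduction of PUBLISHED work; template of the Balaban lattice Yang–Mills cell).**
J. Dimock, *The renormalization group according to Balaban. II. Large fields*, J. Math. Phys. **54** (2013) 092301
(= arXiv:1212.5562v2) [Dimock2013BalabanII], §2.4 "a variation" (TeX L952–1046): the localized action (louie) L958–964,
the star form L965–975, the geometry (geometry) L982–994, Lemma 2.4 (the fourth `lem` of the source, L1000–1015; listed
as «Lem 2.4 = jstar» in TEMPLATE.md §9) with its proof L1020–1043, which invokes Appendix B (zero) (L1029–1033) and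
Theorem 2.1 (unknown) (L1043).  TeX line numbers refer to the arXiv source held by the cell
(`inputs/files/dimock/src/1212.5562/1212.5562.tex`, 7217 lines).

**What the paper prints (verbatim).**  L958–966: *"We actually use a variation of the previous section. First suppose Λ
is any union of M-cubes in 𝕋^{−k}_{M+N−k} and define S*_k(Λ, Φ_{k,Ω}, φ) = ½‖𝐚^{1/2}(Φ_{k,Ω} − Q_{k,Ω}φ)‖²_Λ + ½‖∂φ‖²_{*,Λ}
+ ½μ̄_k‖φ‖²_Λ  (louie)  Here ‖∂φ‖²_{*,Λ} contains half the bonds that cross the boundary of Λ."*  L982–994: *"Also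
suppose the free action is in a set Λ smaller than Ω₁. In fact suppose we have Ω₁ ⊃ Ω₂ ⊃ ⋯ ⊃ Ω_k ⊃ Λ ⊃ Ω_{k+1}
(geometry) with separation between Ω₁ᶜ and Λ. In that case (louie) becomes S*_k(Λ, Φ_k, φ) = (a_k/2)‖Φ_k − Q_kφ‖²_Λ +
½‖∂φ‖²_{*,Λ} + ½μ̄_k‖φ‖²_Λ"*; L995–997: *"We study what happens to this expression if we make expansions around the
minimizer for the original problem φ = φ_{k,Ω} = φ_{k,Ω}(φ_{Ωᶜ}, Φ_{k,Ω}) (which satisfies useful identities). Although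
this is not the minimizer for the current problem we will obtain a similar result."*  **Lemma 2.4** (L1000–1015): *"For
Z : 𝕋⁰_{M+N−k} → ℝ and 𝒵 : 𝕋^{−k}_{M+N−k} → ℝ each defined on a neighborhood of Λ:  S*_k(Λ, Φ_k + Z, φ_{k,Ω} + 𝒵) =
S*_k(Λ, Φ_k, φ_{k,Ω}) + S*_k(Λ, Z, 𝒵) + a_k⟨Z, (Φ_k − Q_kφ_{k,Ω})⟩_Λ + 𝔟_Λ(∂φ_{k,Ω}, 𝒵)  where the boundary term is
𝔟_Λ(∂φ, 𝒵) ≡ ½ Σ_{x∈Λ, x′∈Λᶜ} L^{−2k} ∂φ(x,x′)(𝒵(x) + 𝒵(x′))"*; proof (L1020–1043): *"Everything is quadratic so it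
suffices to identify cross terms. These are a_k⟨Z, (Φ_k − Q_kφ_{k,Ω})⟩_Λ − a_k⟨(Φ_k − Q_kφ_{k,Ω}), Q_k𝒵⟩_Λ + ⟨∂φ_{k,Ω},
∂𝒵⟩_{*,Λ} + μ̄_k⟨φ_{k,Ω}, 𝒵⟩_Λ.  In appendix B it is shown that ⟨∂φ_{k,Ω}, ∂𝒵⟩_{*,Λ} = ⟨(−Δ)φ_{k,Ω}, 𝒵⟩_Λ +
𝔟_Λ(∂φ_{k,Ω}, 𝒵).  Then our expression becomes a_k⟨Z, (Φ_k − Q_kφ_{k,Ω})⟩_Λ − a_k⟨Q_kᵀΦ_k, 𝒵⟩_Λ + ⟨(−Δ + μ̄_k +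
a_kQ_kᵀQ_k)φ_{k,Ω}, 𝒵⟩_Λ + 𝔟_Λ(∂φ_{k,Ω}, 𝒵).  But the second and third terms combine to zero by the definition (unknown)
of φ_{k,Ω}. There is no contribution from φ_{Ω₁ᶜ} due to our separation assumption. This completes the proof."*

**What is reproduced here (kernel-checked, zero `sorry`).**  CARRIER = that of the sibling `StarFormIdentity` (which
proved Appendix B (zero) there): an ARBITRARY finite simple graph `G` on `V` (the fine lattice `𝕋^{−k}` with its bonds),
volume weight `w` (print `L^{−3k}`) and spacing `h` (print `L^{−k}`, so `L^{−2k} = w/h`), ANY vertex set `Λ : Finset V`;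
in addition a finite unit-lattice index type `Y` (`𝕋⁰`) with the unit sites `Λ′ : Finset Y` of `Λ`, and an ARBITRARY
averaging kernel `Qk : Y → V → ℝ`, `(Q_kφ)(y) = Σ_x Q_k(y,x)φ(x)` (print: `Q_k(y,x) = L^{−3k}` for `x` in the
`L^k`-cube of `y`).  Inner products: `⟨Z, W⟩_Λ = Σ_{y∈Λ′} Z(y)W(y)` on the unit lattice (`ipUnit`), `⟨f, g⟩_Λ = Σ_{x∈Λ}
w f(x)g(x)` on the fine lattice (`ipFine`).  PROVED:
* §1 the localized action `Sstar` = (louie) in the geometry (geometry), i.e. L989–994, with `StarFormIdentity.formStar`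
  for `‖∂φ‖²_{*,Λ}`;
* §2 **THE POLARIZATION** `Sstar_add` (L1020–1028) — for ALL `Φ, φ, Z, 𝒵`, no hypothesis: `S*(Λ, Φ + Z, φ + 𝒵) =
  S*(Λ, Φ, φ) + S*(Λ, Z, 𝒵) + [a_k⟨Z, Φ − Q_kφ⟩_Λ − a_k⟨Φ − Q_kφ, Q_k𝒵⟩_Λ + ⟨∂φ, ∂𝒵⟩_{*,Λ} + μ̄_k⟨φ, 𝒵⟩_Λ]`;
* §3 **THE CANCELLATION** `cross_eq_bdry` (L1029–1043): `−a_k⟨Φ − Q_kφ, Q_k𝒵⟩_Λ + ⟨∂φ, ∂𝒵⟩_{*,Λ} + μ̄_k⟨φ, 𝒵⟩_Λ =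
  𝔟_Λ(∂φ, 𝒵)`, from App. B (zero) (`StarFormIdentity.formStar_eq_formLap_add_bdry`, a theorem) and the two facts the
  print invokes, carried as EXPLICIT HYPOTHESES: (H1) *"by the definition (unknown) of φ_{k,Ω} … no contribution from
  φ_{Ω₁ᶜ} due to our separation assumption"* = the variational equation of Theorem 2.1 AT THE SITES OF `Λ`, pointwise
  (`VarEqOn`: `w[(−Δφ)(x) + μ̄_kφ(x)] + a_kΣ_y Q_k(y,x)((Q_kφ)(y) − Φ_k(y)) = 0` for `x ∈ Λ` — this is
  `w·[(−Δ + μ̄_k + a_kQ_kᵀQ_k)φ − a_kQ_kᵀΦ_k](x)` with `Q_kᵀ` the adjoint for the pair of inner products above), and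
  (H2) the block structure behind *"Λ is any union of M-cubes"* (`BlockLocal`: `Q_k(y,x) ≠ 0` only when `y ∈ Λ′` and
  `x ∈ Λ` agree), which is what moves `Q_k` across `⟨·,·⟩_Λ`;
* **LEMMA 2.4** `lemma24`: under (H1)–(H2), `S*(Λ, Φ_k + Z, φ_{k,Ω} + 𝒵) = S*(Λ, Φ_k, φ_{k,Ω}) + S*(Λ, Z, 𝒵) +
  a_k⟨Z, Φ_k − Q_kφ_{k,Ω}⟩_Λ + 𝔟_Λ(∂φ_{k,Ω}, 𝒵)`;
* §4 (v1.1) **(H1) FROM THEOREM 2.1** (`varEqOn_of_variational_eq`, `varEqOn_minimizer`): *"by the definition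
  (unknown) of φ_{k,Ω} … There is no contribution from φ_{Ω₁ᶜ} due to our separation assumption"* made explicit — if
  `φ` solves the variational equation of Theorem 2.1 in `MultiRegionFreeFlow`'s split `Y ⊕ τ` (the level-`k` block
  `Q_k` with weight `a_k`, the layers `Q_τ` with weight `𝐚_τ`; in particular `φ = MultiRegionFreeFlow.minimizer …`, whose
  equation is the theorem `MultiRegionFreeFlow.variational_eq`), and at the sites of `Λ` (α) the rows of
  `D = [−Δ + μ̄_k]_{Ω₁}` are those of the lattice operator `w(−Δ + μ̄_k)` of the graph, (β) the layers do not meet `Λ`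
  (`Q_τ(t,x) = 0`, the geometry (geometry)), (γ) the boundary source `[Δ]_{Ω₁,Ω₁ᶜ}φ_{Ω₁ᶜ}` vanishes on `Λ` (the
  separation), then (H1) holds on `Λ`, so `lemma24` applies to `φ_{k,Ω}` as printed.

**Deviations (declared).**  (i) graph carrier / abstract kernel `Q_k` (the torus, its cubes and the block average are
an instance); (ii) only the `k`-th component of (louie) is modelled, i.e. the reduced form L989–994 that the print
derives from (geometry) — the layers `Φ_{j,δΩ_j}`, `j < k`, do not meet `Λ`; (iii) the two facts used at L1043 are
hypotheses of `lemma24` (the variational equation on `Λ`, the block locality); since v1.1, (H1) is DERIVED (§4) for the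
minimizer of `MultiRegionFreeFlow` on the fine-site carrier `κ = V` under the three geometric facts (α)–(γ) that the
print's *"separation"* provides — in §4 read `V = 𝕋^{−k}_{𝖬+𝖭−k} ∩ Ω₁` (the printed domain of `φ_{k,Ω}`, L604) with the
bonds inside `Ω₁`; by the separation L987 every bond star of a `Λ`-site lies in `Ω₁`, so `Sstar`∕`formStar`∕`bdry` at `Λ`
are the torus ones (XREAD l.2530 F1) — these remain hypotheses about the regions; (H2) is DISCHARGED since v1.2 (§6)
for every kernel supported on the cubes of a block map (`blockLocal_of_support`, `blockLocal_Qmat`), the regions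
`Λ = ⋃_{y∈Λ′}B(y)` being exactly the unions of cubes.

**What is NOT claimed.**  Lemma 2.5 (otto2) and `R_{k,Ω,Λ}` (L1047–1117), the random-walk material of §2.5, anything
of B1–B16 (TEMPLATE.md §4.2 row «D2 §2.3 Lemmas 2.3, 2.5 … §2.4» maps the boundary-term mechanism to B11 Thm 1's
multi-region geometry and B14 §3, grade P).  NOT summit progress; NOT a statement about any Bałaban paper; NOT
continuum; NOT Clay.  Unit `b2b-balaban-template` gen 29 (journal CLAIM D2-LEMMA24-JSTAR-KERNEL).

**Version.**  v1.2 — ADDITIVE to v1.1 (p199574, commit 488aaa9cc691; every v1.1 declaration byte-identical): §6 "(H2) from a block map"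
(`blockLocal_of_support`, `blockLocal_indicator`, `blockLocal_Qmat`) and the import of `BlockAveragingMatrix` (Mathlib-only
leaf of this lineage); docstring-only fold of XREAD VERDICT l.2530 F1 (carrier gloss for §4, deviation (iii)); I1∕I2 noted.
v1.1 — ADDITIVE: §4 "(H1) from Theorem 2.1" (`varEqOn_of_variational_eq`, `varEqOn_minimizer`, private
plumbing, a second non-vacuity `example`) and the import of `MultiRegionFreeFlow`; the (unknown) locator
sharpened to L603–609 (display L605–609); every v1 declaration, statement and proof is unchanged (p198973).
-/

noncomputable section

open Finset

namespace Literature.MathematicalPhysics.QuantumFieldTheory.Dimock2011to13.LocalizedActionExpansion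

open Literature.MathematicalPhysics.QuantumFieldTheory.Dimock2011to13.StarFormIdentity

variable {V : Type*} (G : SimpleGraph V) [DecidableRel G.Adj] [Fintype V] [DecidableEq V]
variable {Y : Type*} [Fintype Y]

/-! ## §1 The objects of §2.4 -/

/-- the averaging operator as a kernel: `(Q_kφ)(y) = Σ_x Q_k(y,x)φ(x)` (print: the block average, L462–469).
[cite: Dimock2013BalabanII, §2.1 L462–469 and §2.4 L989–994 (arXiv:1212.5562v2 TeX)] -/
def Qapp (Qk : Y → V → ℝ) (φ : V → ℝ) (y : Y) : ℝ := ∑ x, Qk y x * φ x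

/-- `⟨Z, W⟩_Λ = Σ_{y∈Λ′} Z(y)W(y)` — the unit-lattice inner product over the unit sites of `Λ`.
[cite: Dimock2013BalabanII, §2.4 Lemma 2.4 L1006–1007 (arXiv:1212.5562v2 TeX)] -/
def ipUnit (Λ' : Finset Y) (Z W : Y → ℝ) : ℝ := ∑ y ∈ Λ', Z y * W y

/-- `⟨f, g⟩_Λ = Σ_{x∈Λ} w f(x)g(x)` — the fine-lattice inner product over `Λ` (`w = L^{−3k}`).
[cite: Dimock2013BalabanII, §2.4 L1026 and App. B L6532 (arXiv:1212.5562v2 TeX)] -/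
def ipFine (w : ℝ) (Λ : Finset V) (f g : V → ℝ) : ℝ := ∑ x ∈ Λ, w * (f x * g x)

/-- **the localized action** `S*_k(Λ, Φ_k, φ) = (a_k/2)‖Φ_k − Q_kφ‖²_Λ + ½‖∂φ‖²_{*,Λ} + ½μ̄_k‖φ‖²_Λ` ((louie) in the
geometry (geometry)), the star form being `StarFormIdentity.formStar` (*"contains half the bonds that cross the boundary
of Λ"*). [cite: Dimock2013BalabanII, §2.4 (louie) L958–970 and L982–994 (arXiv:1212.5562v2 TeX)] -/
def Sstar (w h ak μ : ℝ) (Λ : Finset V) (Λ' : Finset Y) (Qk : Y → V → ℝ) (Φ : Y → ℝ) (φ : V → ℝ) : ℝ :=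
  (ak / 2) * ipUnit Λ' (Φ - Qapp Qk φ) (Φ - Qapp Qk φ) + (1 / 2) * formStar G w h Λ φ φ
    + (μ / 2) * ipFine w Λ φ φ

/-- (H1) the variational equation of Theorem 2.1 (unknown) AT THE SITES OF `Λ`, pointwise and multiplied by `w`:
`w[(−Δφ)(x) + μ̄_kφ(x)] + a_k Σ_y Q_k(y,x)((Q_kφ)(y) − Φ_k(y)) = 0` for `x ∈ Λ` — i.e.
`[(−Δ + μ̄_k + a_kQ_kᵀQ_k)φ − a_kQ_kᵀΦ_k](x) = 0`, where `(Q_kᵀΨ)(x) = w⁻¹Σ_y Q_k(y,x)Ψ(y)` is the adjoint for the pair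
(`Σ_{y}`, `Σ_x w`); *"no contribution from φ_{Ω₁ᶜ} due to our separation assumption"*.
[cite: Dimock2013BalabanII, Thm 2.1 (unknown) L603–609, L634–641 and §2.4 L1043 (arXiv:1212.5562v2 TeX)] -/
def VarEqOn (w h ak μ : ℝ) (Λ : Finset V) (Qk : Y → V → ℝ) (Φ : Y → ℝ) (φ : V → ℝ) : Prop :=
  ∀ x ∈ Λ, w * negLap G h φ x + w * (μ * φ x) + ak * ∑ y, Qk y x * (Qapp Qk φ y - Φ y) = 0

/-- (H2) block locality of `Q_k` relative to `Λ` (*"Λ is any union of M-cubes"*, so of `L^k`-cubes): the kernel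
`Q_k(y,x)` vanishes unless `y ∈ Λ′` and `x ∈ Λ` agree. [cite: Dimock2013BalabanII, §2.4 L958 and §2.1 L462–469
(arXiv:1212.5562v2 TeX)] -/
def BlockLocal (Λ : Finset V) (Λ' : Finset Y) (Qk : Y → V → ℝ) : Prop :=
  (∀ y ∈ Λ', ∀ x, x ∉ Λ → Qk y x = 0) ∧ (∀ y, y ∉ Λ' → ∀ x ∈ Λ, Qk y x = 0)

/-! ### [folklore] bilinear bookkeeping -/

section Bilinear

variable {Λ : Finset V} {Λ' : Finset Y} {w h : ℝ}

omit [Fintype Y] in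
/-- `⟨a + b, a + b⟩ = ⟨a,a⟩ + 2⟨a,b⟩ + ⟨b,b⟩` on the unit lattice. [folklore] -/
private theorem ipUnit_expand (a b : Y → ℝ) :
    ipUnit Λ' (a + b) (a + b) = ipUnit Λ' a a + 2 * ipUnit Λ' a b + ipUnit Λ' b b := by
  unfold ipUnit
  rw [Finset.mul_sum, ← Finset.sum_add_distrib, ← Finset.sum_add_distrib]
  refine Finset.sum_congr rfl fun y _ => ?_
  simp only [Pi.add_apply]
  ring

omit [Fintype Y] in
/-- symmetry. [folklore] -/
private theorem ipUnit_comm (a b : Y → ℝ) : ipUnit Λ' a b = ipUnit Λ' b a := by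
  unfold ipUnit
  exact Finset.sum_congr rfl fun y _ => mul_comm _ _

omit [Fintype Y] in
/-- linearity in the second slot (difference). [folklore] -/
private theorem ipUnit_sub_right (a b c : Y → ℝ) : ipUnit Λ' a (b - c) = ipUnit Λ' a b - ipUnit Λ' a c := by
  unfold ipUnit
  rw [← Finset.sum_sub_distrib]
  refine Finset.sum_congr rfl fun y _ => ?_
  simp only [Pi.sub_apply]
  ring

omit [DecidableRel G.Adj] [Fintype V] [DecidableEq V] [Fintype Y] in
/-- `⟨f + g, f + g⟩_Λ = ⟨f,f⟩_Λ + 2⟨f,g⟩_Λ + ⟨g,g⟩_Λ` on the fine lattice. [folklore] -/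
private theorem ipFine_expand (f g : V → ℝ) :
    ipFine w Λ (f + g) (f + g) = ipFine w Λ f f + 2 * ipFine w Λ f g + ipFine w Λ g g := by
  unfold ipFine
  rw [Finset.mul_sum, ← Finset.sum_add_distrib, ← Finset.sum_add_distrib]
  refine Finset.sum_congr rfl fun x _ => ?_
  simp only [Pi.add_apply]
  ring

omit [DecidableRel G.Adj] [Fintype V] [DecidableEq V] [Fintype Y] in
/-- `∂(f + g) = ∂f + ∂g`. [folklore] -/
private theorem sgrad_add (h : ℝ) (f g : V → ℝ) (x x' : V) :
    sgrad h (f + g) x x' = sgrad h f x x' + sgrad h g x x' := by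
  unfold sgrad
  simp only [Pi.add_apply]
  ring

omit [Fintype Y] in
/-- `‖∂(f + g)‖²_{*,Λ} = ‖∂f‖²_{*,Λ} + 2⟨∂f,∂g⟩_{*,Λ} + ‖∂g‖²_{*,Λ}`. [folklore] -/
private theorem formStar_expand (f g : V → ℝ) :
    formStar G w h Λ (f + g) (f + g) = formStar G w h Λ f f + 2 * formStar G w h Λ f g + formStar G w h Λ g g := by
  rw [formStar_eq_half_sum, formStar_eq_half_sum, formStar_eq_half_sum, formStar_eq_half_sum]
  have hpt : ∀ x x', w * sgrad h (f + g) x x' * sgrad h (f + g) x x'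
      = w * sgrad h f x x' * sgrad h f x x' + 2 * (w * sgrad h f x x' * sgrad h g x x')
        + w * sgrad h g x x' * sgrad h g x x' := fun x x' => by
    rw [sgrad_add]
    ring
  simp only [hpt, Finset.sum_add_distrib, ← Finset.mul_sum]
  ring

omit [DecidableRel G.Adj] [DecidableEq V] [Fintype Y] in
/-- `Q_k(φ + 𝒵) = Q_kφ + Q_k𝒵`. [folklore] -/
private theorem Qapp_add (Qk : Y → V → ℝ) (φ 𝒵 : V → ℝ) : Qapp Qk (φ + 𝒵) = Qapp Qk φ + Qapp Qk 𝒵 := by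
  funext y
  simp only [Qapp, Pi.add_apply, mul_add, Finset.sum_add_distrib]

end Bilinear

/-! ## §2 The polarization (L1020–1028) -/

section Polarization

variable {w h ak μ : ℝ} {Λ : Finset V} {Λ' : Finset Y} {Qk : Y → V → ℝ}

omit [DecidableEq V] [Fintype Y] in
/-- **THE CROSS TERMS** — *"Everything is quadratic so it suffices to identify cross terms. These are a_k⟨Z, (Φ_k −
Q_kφ_{k,Ω})⟩_Λ − a_k⟨(Φ_k − Q_kφ_{k,Ω}), Q_k𝒵⟩_Λ + ⟨∂φ_{k,Ω}, ∂𝒵⟩_{*,Λ} + μ̄_k⟨φ_{k,Ω}, 𝒵⟩_Λ"*: for ALL `Φ, φ, Z, 𝒵`.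
[cite: Dimock2013BalabanII, §2.4 Lemma 2.4 proof L1020–1028 (arXiv:1212.5562v2 TeX)] -/
theorem Sstar_add [DecidableEq V] (Φ Z : Y → ℝ) (φ 𝒵 : V → ℝ) :
    Sstar G w h ak μ Λ Λ' Qk (Φ + Z) (φ + 𝒵)
      = Sstar G w h ak μ Λ Λ' Qk Φ φ + Sstar G w h ak μ Λ Λ' Qk Z 𝒵
        + (ak * ipUnit Λ' Z (Φ - Qapp Qk φ) - ak * ipUnit Λ' (Φ - Qapp Qk φ) (Qapp Qk 𝒵)
          + formStar G w h Λ φ 𝒵 + μ * ipFine w Λ φ 𝒵) := by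
  have hsplit : Φ + Z - Qapp Qk (φ + 𝒵) = (Φ - Qapp Qk φ) + (Z - Qapp Qk 𝒵) := by
    rw [Qapp_add]
    abel
  have hcross : ipUnit Λ' (Φ - Qapp Qk φ) (Z - Qapp Qk 𝒵)
      = ipUnit Λ' Z (Φ - Qapp Qk φ) - ipUnit Λ' (Φ - Qapp Qk φ) (Qapp Qk 𝒵) := by
    rw [ipUnit_sub_right, ipUnit_comm (Φ - Qapp Qk φ) Z]
  unfold Sstar
  rw [hsplit, ipUnit_expand, formStar_expand, ipFine_expand, hcross]
  ring

end Polarization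

/-! ## §3 The cancellation (L1029–1043) and Lemma 2.4 -/

section Lemma24

variable {w h ak μ : ℝ} {Λ : Finset V} {Λ' : Finset Y} {Qk : Y → V → ℝ} {Φ : Y → ℝ} {φ : V → ℝ}

omit [DecidableRel G.Adj] [DecidableEq V] in
/-- under block locality, `⟨Φ − Q_kφ, Q_k𝒵⟩_Λ = Σ_{x∈Λ} 𝒵(x) Σ_y Q_k(y,x)(Φ − Q_kφ)(y)` — moving `Q_k` across the
restricted inner products (the print's `⟨u, Q_k𝒵⟩_Λ = ⟨Q_kᵀu, 𝒵⟩_Λ`, L1025 → L1038). [folklore] -/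
private theorem ipUnit_Qapp_eq_sum (hQ : BlockLocal Λ Λ' Qk) (u : Y → ℝ) (𝒵 : V → ℝ) :
    ipUnit Λ' u (Qapp Qk 𝒵) = ∑ x ∈ Λ, 𝒵 x * ∑ y, Qk y x * u y := by
  unfold ipUnit Qapp
  -- restrict the inner x-sum to Λ (blocks of Λ′-sites lie in Λ)
  have h1 : ∀ y ∈ Λ', u y * ∑ x, Qk y x * 𝒵 x = ∑ x ∈ Λ, u y * (Qk y x * 𝒵 x) := by
    intro y hy
    rw [Finset.mul_sum]
    symm
    refine Finset.sum_subset (Finset.subset_univ Λ) fun x _ hx => ?_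
    rw [hQ.1 y hy x hx, zero_mul, mul_zero]
  rw [Finset.sum_congr rfl h1, Finset.sum_comm]
  refine Finset.sum_congr rfl fun x hx => ?_
  -- extend the y-sum from Λ′ to all of Y (Λ-sites belong to Λ′-blocks)
  rw [Finset.mul_sum]
  refine (Finset.sum_subset (Finset.subset_univ Λ') fun y _ hy => ?_).trans ?_
  · rw [hQ.2 y hy x hx, zero_mul, mul_zero]
  · exact Finset.sum_congr rfl fun y _ => by ring

omit [DecidableEq V] in
/-- **THE CANCELLATION**: *"In appendix B it is shown that ⟨∂φ_{k,Ω}, ∂𝒵⟩_{*,Λ} = ⟨(−Δ)φ_{k,Ω}, 𝒵⟩_Λ + 𝔟_Λ(∂φ_{k,Ω}, 𝒵).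
Then our expression becomes a_k⟨Z, (Φ_k − Q_kφ_{k,Ω})⟩_Λ − a_k⟨Q_kᵀΦ_k, 𝒵⟩_Λ + ⟨(−Δ + μ̄_k + a_kQ_kᵀQ_k)φ_{k,Ω}, 𝒵⟩_Λ +
𝔟_Λ(∂φ_{k,Ω}, 𝒵). But the second and third terms combine to zero by the definition (unknown) of φ_{k,Ω}"* — under (H1)
`VarEqOn` and (H2) `BlockLocal`: `−a_k⟨Φ − Q_kφ, Q_k𝒵⟩_Λ + ⟨∂φ, ∂𝒵⟩_{*,Λ} + μ̄_k⟨φ, 𝒵⟩_Λ = 𝔟_Λ(∂φ, 𝒵)`.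
[cite: Dimock2013BalabanII, §2.4 Lemma 2.4 proof L1029–1043 (arXiv:1212.5562v2 TeX)] -/
theorem cross_eq_bdry [DecidableEq V] (hvar : VarEqOn G w h ak μ Λ Qk Φ φ) (hQ : BlockLocal Λ Λ' Qk) (𝒵 : V → ℝ) :
    -(ak * ipUnit Λ' (Φ - Qapp Qk φ) (Qapp Qk 𝒵)) + formStar G w h Λ φ 𝒵 + μ * ipFine w Λ φ 𝒵
      = bdry G w h Λ φ 𝒵 := by
  -- App. B (zero)
  rw [formStar_eq_formLap_add_bdry, ipUnit_Qapp_eq_sum hQ]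
  -- everything except 𝔟_Λ is Σ_{x∈Λ} 𝒵(x)·(the variational equation at x)
  have hsum : -(ak * ∑ x ∈ Λ, 𝒵 x * ∑ y, Qk y x * (Φ - Qapp Qk φ) y) + formLap G w h Λ φ 𝒵 + μ * ipFine w Λ φ 𝒵
      = ∑ x ∈ Λ, 𝒵 x * (w * negLap G h φ x + w * (μ * φ x) + ak * ∑ y, Qk y x * (Qapp Qk φ y - Φ y)) := by
    unfold formLap ipFine
    rw [Finset.mul_sum, Finset.mul_sum, ← Finset.sum_neg_distrib, ← Finset.sum_add_distrib,
      ← Finset.sum_add_distrib]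
    refine Finset.sum_congr rfl fun x _ => ?_
    have hneg : ∑ y, Qk y x * (Φ - Qapp Qk φ) y = -∑ y, Qk y x * (Qapp Qk φ y - Φ y) := by
      rw [← Finset.sum_neg_distrib]
      refine Finset.sum_congr rfl fun y _ => ?_
      simp only [Pi.sub_apply]
      ring
    rw [hneg]
    ring
  have hzero : ∑ x ∈ Λ, 𝒵 x * (w * negLap G h φ x + w * (μ * φ x) + ak * ∑ y, Qk y x * (Qapp Qk φ y - Φ y)) = 0 :=
    Finset.sum_eq_zero fun x hx => by rw [hvar x hx, mul_zero]
  linarith [hsum, hzero]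

omit [DecidableEq V] in
/-- **LEMMA 2.4** ([Dimock2013BalabanII] §2.4): for `φ = φ_{k,Ω}` satisfying the variational equation of Theorem 2.1 on
`Λ` (H1) and a block-local `Q_k` (H2), and ALL `Z`, `𝒵`:
`S*_k(Λ, Φ_k + Z, φ_{k,Ω} + 𝒵) = S*_k(Λ, Φ_k, φ_{k,Ω}) + S*_k(Λ, Z, 𝒵) + a_k⟨Z, (Φ_k − Q_kφ_{k,Ω})⟩_Λ + 𝔟_Λ(∂φ_{k,Ω}, 𝒵)`.
[cite: Dimock2013BalabanII, §2.4 Lemma 2.4 L1000–1015, proof L1020–1043 (arXiv:1212.5562v2 TeX)] -/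
theorem lemma24 [DecidableEq V] (hvar : VarEqOn G w h ak μ Λ Qk Φ φ) (hQ : BlockLocal Λ Λ' Qk) (Z : Y → ℝ)
    (𝒵 : V → ℝ) :
    Sstar G w h ak μ Λ Λ' Qk (Φ + Z) (φ + 𝒵)
      = Sstar G w h ak μ Λ Λ' Qk Φ φ + Sstar G w h ak μ Λ Λ' Qk Z 𝒵
        + ak * ipUnit Λ' Z (Φ - Qapp Qk φ) + bdry G w h Λ φ 𝒵 := by
  rw [Sstar_add, ← cross_eq_bdry G hvar hQ 𝒵]
  ring

omit [DecidableEq V] in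
/-- the boundary term vanishes when `𝒵` is supported away from the boundary bonds of `Λ` (no `x ∈ Λ`, `x′ ∉ Λ`, `x′ ∼ x`
with `𝒵(x) + 𝒵(x′) ≠ 0`): then Lemma 2.4 has no `𝔟_Λ` — the whole-torus situation of §2.3.
[cite: Dimock2013BalabanII, §2.4 Lemma 2.4 L1010–1014 (arXiv:1212.5562v2 TeX)] -/
theorem bdry_eq_zero_of_support [DecidableEq V] (φ 𝒵 : V → ℝ)
    (h𝒵 : ∀ x ∈ Λ, ∀ x' ∈ G.neighborFinset x \ Λ, 𝒵 x + 𝒵 x' = 0) : bdry G w h Λ φ 𝒵 = 0 := by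
  unfold bdry
  rw [Finset.sum_eq_zero fun x hx => Finset.sum_eq_zero fun x' hx' => by rw [h𝒵 x hx x' hx', mul_zero], mul_zero]

end Lemma24

/-! ## §4 (v1.1) The hypothesis (H1) from Theorem 2.1: the variational equation read at the sites of `Λ` -/

section FromTheorem21

open Matrix
open Literature.MathematicalPhysics.QuantumFieldTheory.Dimock2011to13.MultiRegionFreeFlow

variable {τ : Type*} [Fintype τ] [DecidableEq Y]
variable {w h ak μ : ℝ} {Λ : Finset V} {D : Matrix V V ℝ} {aτ : Matrix τ τ ℝ} {Qk : Matrix Y V ℝ}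
  {Qτ : Matrix τ V ℝ} {Φ : Y → ℝ} {Φτ : τ → ℝ} {src : V → ℝ}

omit [DecidableEq V] [Fintype Y] [DecidableEq Y] in
/-- the kernel form is the matrix action: `(Q_kφ)(y) = (Q_k *ᵥ φ)(y)`. [folklore] -/
private theorem Qapp_eq_mulVec (Qk : Matrix Y V ℝ) (φ : V → ℝ) : Qapp Qk φ = Qk *ᵥ φ := rfl

omit [Fintype V] [DecidableEq V] in
/-- `(Mᵀ *ᵥ v)(x) = Σ_y M(y,x) v(y)`. [folklore] -/
private theorem transpose_mulVec_apply {m : Type*} [Fintype m] (M : Matrix m V ℝ) (v : m → ℝ) (x : V) :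
    (Mᵀ *ᵥ v) x = ∑ y, M y x * v y := rfl

/-- the split weight `a_k ⊕ 𝐚_τ` is positive semidefinite for `a_k ≥ 0`, `𝐚_τ ≥ 0` (as in `MultiRegionFreeFlow`, where
the lemma is private). [folklore] -/
private theorem weightO_psd (hak : 0 ≤ ak) (haτ : aτ.PosSemidef) : (weightO (ι := Y) ak aτ).PosSemidef := by
  have hH : (weightO (ι := Y) ak aτ).IsHermitian := by
    unfold weightO
    refine Matrix.IsHermitian.fromBlocks ?_ (by simp) haτ.isHermitian
    rw [IsHermitian, conjTranspose_smul, star_trivial, conjTranspose_one]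
  refine PosSemidef.of_dotProduct_mulVec_nonneg hH fun x => ?_
  rw [star_trivial]
  unfold weightO
  conv_rhs => rw [← Sum.elim_comp_inl_inr x, fromBlocks_mulVec]
  simp only [Sum.elim_comp_inl, Sum.elim_comp_inr, zero_mulVec, add_zero, zero_add, sumElim_dotProduct_sumElim,
    smul_mulVec, one_mulVec, dotProduct_smul, smul_eq_mul]
  have h1 : 0 ≤ (x ∘ Sum.inl) ⬝ᵥ (x ∘ Sum.inl) := Finset.sum_nonneg fun i _ => mul_self_nonneg _
  have h2 : 0 ≤ (x ∘ Sum.inr) ⬝ᵥ (aτ *ᵥ (x ∘ Sum.inr)) := by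
    have := haτ.dotProduct_mulVec_nonneg (x ∘ Sum.inr)
    rwa [star_trivial] at this
  exact add_nonneg (mul_nonneg hak h1) h2

omit [DecidableEq V] in
/-- the left side of the variational equation at a site `x`, in the split `Y ⊕ τ`:
`([D + Q_{k,Ω}ᵀ𝐚Q_{k,Ω}]φ)(x) = (Dφ)(x) + Σ_t Q_τ(t,x)(𝐚_τQ_τφ)(t) + a_kΣ_y Q_k(y,x)(Q_kφ)(y)`. [folklore] -/
private theorem gInvO_mulVec_apply (φ : V → ℝ) (x : V) :
    (gInvO D (weightO ak aτ) (rowsO Qk Qτ) *ᵥ φ) x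
      = (D *ᵥ φ) x + ∑ t, Qτ t x * (aτ *ᵥ (Qτ *ᵥ φ)) t + ak * ∑ y, Qk y x * (Qk *ᵥ φ) y := by
  rw [gInvO_block]
  unfold restE
  rw [add_mulVec, add_mulVec, smul_mulVec, ← mulVec_mulVec, ← mulVec_mulVec, ← mulVec_mulVec]
  simp only [Pi.add_apply, Pi.smul_apply, smul_eq_mul, transpose_mulVec_apply]

omit [Fintype V] [DecidableEq V] in
/-- the right side at `x`: `(Q_{k,Ω}ᵀ𝐚Φ_{k,Ω} + src)(x) = a_kΣ_y Q_k(y,x)Φ(y) + Σ_t Q_τ(t,x)(𝐚_τΦ_τ)(t) + src(x)`. [folklore] -/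
private theorem rhs_apply (x : V) :
    ((rowsO Qk Qτ)ᵀ *ᵥ (weightO ak aτ *ᵥ Sum.elim Φ Φτ) + src) x
      = ak * ∑ y, Qk y x * Φ y + ∑ t, Qτ t x * (aτ *ᵥ Φτ) t + src x := by
  unfold rowsO weightO
  rw [transpose_fromRows, fromBlocks_mulVec]
  simp only [Sum.elim_comp_inl, Sum.elim_comp_inr, zero_mulVec, add_zero, zero_add, smul_mulVec, one_mulVec,
    fromCols_mulVec_sumElim, Pi.add_apply, transpose_mulVec_apply, Pi.smul_apply, smul_eq_mul]
  rw [Finset.mul_sum]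
  congr 1; congr 1
  exact Finset.sum_congr rfl fun y _ => by ring

omit [DecidableEq V] in
/-- **(H1) FROM THE VARIATIONAL EQUATION.**  Let `φ` solve the variational equation (unknown) of Theorem 2.1 on the
fine sites, in `MultiRegionFreeFlow`'s split `Y ⊕ τ` of the multiscale variable (level-`k` block `Q_k` with weight
`a_k`, the layers `Q_τ` with weight `𝐚_τ`): `[D + Q_{k,Ω}ᵀ𝐚Q_{k,Ω}]φ = Q_{k,Ω}ᵀ𝐚Φ_{k,Ω} + src`.  If at the sites of `Λ`
(α) the rows of `D = [−Δ + μ̄_k]_{Ω₁}` are those of the lattice operator `w(−Δ + μ̄_k)`, (β) the layers do not meet `Λ`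
(`Q_τ(t,x) = 0` for `x ∈ Λ` — the geometry (geometry): `δΩ_j ∩ Ω_k = ∅` for `j < k` and `Λ ⊂ Ω_k`), and (γ) the
boundary source vanishes on `Λ` (*"separation between Ω₁ᶜ and Λ"*, *"There is no contribution from φ_{Ω₁ᶜ} due to our
separation assumption"*), then (H1) `VarEqOn` holds: this is *"by the definition (unknown) of φ_{k,Ω}"* made explicit.
[cite: Dimock2013BalabanII, Thm 2.1 (unknown) L603–609, proof L634–641; §2.4 (geometry) L982–988 and L1043
(arXiv:1212.5562v2 TeX)] -/
theorem varEqOn_of_variational_eq {φ : V → ℝ}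
    (hsol : gInvO D (weightO ak aτ) (rowsO Qk Qτ) *ᵥ φ = (rowsO Qk Qτ)ᵀ *ᵥ (weightO ak aτ *ᵥ Sum.elim Φ Φτ) + src)
    (hD : ∀ x ∈ Λ, (D *ᵥ φ) x = w * negLap G h φ x + w * (μ * φ x))
    (hτ : ∀ t, ∀ x ∈ Λ, Qτ t x = 0) (hsrc : ∀ x ∈ Λ, src x = 0) :
    VarEqOn G w h ak μ Λ Qk Φ φ := by
  intro x hx
  have h1 := congrFun hsol x
  have hτ1 : ∑ t, Qτ t x * (aτ *ᵥ (Qτ *ᵥ φ)) t = 0 := Finset.sum_eq_zero fun t _ => by rw [hτ t x hx, zero_mul]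
  have hτ2 : ∑ t, Qτ t x * (aτ *ᵥ Φτ) t = 0 := Finset.sum_eq_zero fun t _ => by rw [hτ t x hx, zero_mul]
  rw [gInvO_mulVec_apply, rhs_apply, hD x hx, hsrc x hx, hτ1, hτ2] at h1
  have hsplit : ∑ y, Qk y x * (Qapp Qk φ y - Φ y) = ∑ y, Qk y x * (Qk *ᵥ φ) y - ∑ y, Qk y x * Φ y := by
    rw [← Finset.sum_sub_distrib, Qapp_eq_mulVec]
    exact Finset.sum_congr rfl fun y _ => by ring
  rw [hsplit]
  linarith

/-- **(H1) FOR THE MINIMIZER `φ_{k,Ω}` OF THEOREM 2.1** (`MultiRegionFreeFlow.minimizer`, whose variational equation is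
the theorem `MultiRegionFreeFlow.variational_eq`): for `D > 0` with lattice rows on `Λ` (α), `𝐚_τ ≥ 0`, `a_k ≥ 0`, the
layers off `Λ` (β) and the source off `Λ` (γ), the field `φ_{k,Ω}(φ_{Ω₁ᶜ}, Φ_{k,Ω})` satisfies (H1) on `Λ` — so
`lemma24` applies to it as printed. [cite: Dimock2013BalabanII, Thm 2.1 (unknown) L603–609; §2.4 L995–997, Lemma 2.4
L1000–1015, L1043 (arXiv:1212.5562v2 TeX)] -/
theorem varEqOn_minimizer [DecidableEq τ] (hDpos : D.PosDef) (haτ : aτ.PosSemidef) (hak : 0 ≤ ak)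
    (hD : ∀ f : V → ℝ, ∀ x ∈ Λ, (D *ᵥ f) x = w * negLap G h f x + w * (μ * f x))
    (hτ : ∀ t, ∀ x ∈ Λ, Qτ t x = 0) (hsrc : ∀ x ∈ Λ, src x = 0) (Φ : Y → ℝ) (Φτ : τ → ℝ) :
    VarEqOn G w h ak μ Λ Qk Φ (minimizer D (weightO ak aτ) (rowsO Qk Qτ) (Sum.elim Φ Φτ) src) :=
  varEqOn_of_variational_eq G (variational_eq hDpos (weightO_psd hak haτ) _ _) (hD _) hτ hsrc

end FromTheorem21

/-! ## §5 Non-vacuity -/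

/-- every hypothesis is satisfiable non-trivially: one fine site, one unit site, the empty graph, `Q_k = 1`, `Λ = Λ′ =`
everything, `w = a_k = μ̄ = 1`; then (H1) reads `φ + (φ − Φ) = 0` and holds for `Φ = 2`, `φ = 1`, and Lemma 2.4 is the
identity `S*(2 + Z, 1 + 𝒵) = S*(2, 1) + S*(Z, 𝒵) + Z·(2 − 1) + 0`. -/
example (Z 𝒵 : Unit → ℝ) :
    Sstar (⊥ : SimpleGraph Unit) 1 1 1 1 (Finset.univ : Finset Unit) (Finset.univ : Finset Unit)
        (fun (_ : Unit) (_ : Unit) => (1 : ℝ)) ((fun _ => (2 : ℝ)) + Z) ((fun _ => (1 : ℝ)) + 𝒵)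
      = Sstar (⊥ : SimpleGraph Unit) 1 1 1 1 (Finset.univ : Finset Unit) (Finset.univ : Finset Unit)
          (fun (_ : Unit) (_ : Unit) => (1 : ℝ)) (fun _ => 2) (fun _ => 1)
        + Sstar (⊥ : SimpleGraph Unit) 1 1 1 1 (Finset.univ : Finset Unit) (Finset.univ : Finset Unit)
          (fun (_ : Unit) (_ : Unit) => (1 : ℝ)) Z 𝒵
        + 1 * ipUnit (Finset.univ : Finset Unit) Z
          ((fun _ => (2 : ℝ)) - Qapp (fun (_ : Unit) (_ : Unit) => (1 : ℝ)) (fun _ => 1))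
        + bdry (⊥ : SimpleGraph Unit) 1 1 (Finset.univ : Finset Unit) (fun _ => (1 : ℝ)) 𝒵 := by
  refine lemma24 (⊥ : SimpleGraph Unit) ?_ ?_ Z 𝒵
  · intro x _
    simp [negLap, Qapp]
    norm_num
  · exact ⟨fun y _ x hx => absurd (Finset.mem_univ x) hx, fun y hy => absurd (Finset.mem_univ y) hy⟩

/-- (v1.1) the hypotheses of `varEqOn_minimizer` are jointly satisfiable: one fine site, one unit site, no layers
(`τ = Fin 0`), `D = Q_k = 1`, `a_k = w = μ̄ = 1`, the empty graph (so `−Δ = 0` and the lattice row condition (α) reads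
`(1·f)(x) = 0 + f(x)`), no source; the minimizer `φ_{k,Ω}` of Theorem 2.1 then satisfies (H1). -/
example (Φ : Unit → ℝ) :
    VarEqOn (⊥ : SimpleGraph Unit) 1 1 1 1 (Finset.univ : Finset Unit) (1 : Matrix Unit Unit ℝ) Φ
      (MultiRegionFreeFlow.minimizer (1 : Matrix Unit Unit ℝ)
        (MultiRegionFreeFlow.weightO (ι := Unit) 1 (0 : Matrix (Fin 0) (Fin 0) ℝ))
        (MultiRegionFreeFlow.rowsO (1 : Matrix Unit Unit ℝ) (0 : Matrix (Fin 0) Unit ℝ)) (Sum.elim Φ 0) 0) := by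
  refine varEqOn_minimizer (⊥ : SimpleGraph Unit) Matrix.PosDef.one Matrix.PosSemidef.zero zero_le_one
    (fun f x _ => by simp [negLap]) (fun t => t.elim0) (fun _ _ => rfl) Φ 0

/-! ## §6 (v1.2) The hypothesis (H2) from a block map: kernels supported on the cubes -/

section BlockGeometry

open Literature.MathematicalPhysics.QuantumFieldTheory.Dimock2011to13.BlockAveragingMatrix

variable [DecidableEq Y]

omit [Fintype Y] [DecidableEq V] in
/-- **(H2) DISCHARGED for block geometries**: for ANY kernel supported on the graph of a block map `b : V → Y`
(`Q_k(y,x) ≠ 0 ⇒ x ∈ B(y)`) and `Λ := ⋃_{y∈Λ′} B(y)` the union of the cubes over `Λ′` — *"Λ is any union of M-cubes"*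
(hence of `L^k`-cubes) — `BlockLocal Λ Λ′ Q_k` holds. [cite: Dimock2013BalabanII, §2.4 L958 and §2.1 L462–469
(arXiv:1212.5562v2 TeX)] -/
theorem blockLocal_of_support (b : V → Y) (Qk : Y → V → ℝ) (hsupp : ∀ y x, Qk y x ≠ 0 → b x = y)
    (Λ' : Finset Y) : BlockLocal (Finset.univ.filter fun x => b x ∈ Λ') Λ' Qk := by
  refine ⟨fun y hy x hx => ?_, fun y hy x hx => ?_⟩
  · by_contra h
    exact hx (Finset.mem_filter.mpr ⟨Finset.mem_univ _, (hsupp y x h).symm ▸ hy⟩)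
  · by_contra h
    have hx' := (Finset.mem_filter.mp hx).2
    rw [hsupp y x h] at hx'
    exact hy hx'

omit [Fintype Y] [DecidableEq V] in
/-- (H2) for the printed kernel `Q_k(y,x) = c·[x ∈ B_k(y)]` (`c = L^{−3k}`). [cite: Dimock2013BalabanII, §2.1 L462–469
(arXiv:1212.5562v2 TeX)] -/
theorem blockLocal_indicator (b : V → Y) (c : ℝ) (Λ' : Finset Y) :
    BlockLocal (Finset.univ.filter fun x => b x ∈ Λ') Λ' (fun y x => if b x = y then c else 0) :=
  blockLocal_of_support b _ (fun y x hq => by by_contra hne; exact hq (if_neg hne)) Λ'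

omit [Fintype Y] [DecidableEq V] in
/-- (H2) for the block-averaging MATRIX `Qmat b N` of this lineage's `BlockAveragingMatrix` (isometric normalisation
`(√N)⁻¹·[b x = y]`; on the torus `b = tcoarse L N′`, `TorusBlockAveraging.Qt`). [cite: Dimock2013BalabanII, §2.1
L462–469 (arXiv:1212.5562v2 TeX); Dimock2013, §2.1 L317–327 (arXiv:1108.1335v2 TeX)] -/
theorem blockLocal_Qmat (b : V → Y) (N : ℕ) (Λ' : Finset Y) :
    BlockLocal (Finset.univ.filter fun x => b x ∈ Λ') Λ' (fun y x => Qmat b N y x) :=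
  blockLocal_indicator b _ Λ'

end BlockGeometry

end Literature.MathematicalPhysics.QuantumFieldTheory.Dimock2011to13.LocalizedActionExpansion
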